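import Summits.QuantumFields.BalabanUV.Beta.GAN24.DressedLegBlockL1MultiplierColumn
import Summits.QuantumFields.BalabanUV.Beta.GAN24.DressedLegBlockL1Envelope
import Summits.QuantumFields.BalabanUV.Beta.GAN24.KSlotAssembly

/-!
# `BalabanUV.Beta.GAN24.DressedLegMultiplierColumnEnvelope` — binder row G-an2-4 ∕ (CONV-C), W-slot, the (α-0) parity re-cut, located crux (Q-L-k₀)
# (RULING R-gan24p1-g36-1 (4)(B), part 3b; leaf-01 g74 W-2 l.53845 (2): «the `f = inr` part of the carrier's kernel leg is LIVE — GO, yours»):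
# **THE MULTIPLIER-COLUMN PART OF THE CARRIER's COMPOSITE KERNEL LEG IS `T^B`-SIZED IN BLOCK-ℓ¹, UNIFORMLY IN THE PAIR OF LEVELS** — the dressed row chain of the
# levels `m+1 … m+k+1` composed at its fine end with the multiplier–multiplier block of the level-`m` unit step kernel (OWNER `b2b-balaban-gan24-p1`, gen 36)

NOT IN PRINT; OUR BOOKKEEPING ([folklore]: part 2's block-ℓ¹ law ⨾ the LANDED K-slot's uniform decay ⨾ part 3a's composition, fibre by fibre; 0 `def`, 0 cited facts,
0 `def … : Prop`, 0 sorry).  HONEST FRAMING (cell contract, verbatim): «discharging `BetaPertH` makes Bałaban's UV stability UNCONDITIONAL — a real constructive-QFT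
result; it is NOT the continuum limit and NOT the Clay problem.»  HONEST DEPENDENCY (verbatim): «continuum YM on T⁴ ⇐ BetaPertH ∧ nine spine estimates (0/9 proved);
BetaPertH ⇐ (D1) ∧ (D4) ∧ CAP+tail; G-an2-4 gates asym, D1 and NE2/3/4.»

WHAT (`d = 3`, `2 ≤ Lc`, in-block root `ρ = toSite rr`).  **`exists_legChain_mmColumn_blockL1_envelope`**: ONE rate `κ₁ > 0` and ONE `K′ ≥ 0` with, for ALL `m k α x″ β c`,
`Σ_{t ∈ box (Lc^{k+2})} |Σ′_{x′} Σ_{α′} legChain (respStepBmSeq ρ Lc) (m+1) k α x″ α′ x′ · (unitK_m (KInvStep Lc m)) (Lc•x′) (Lc^{k+2}•c + t) (inr α′) (inr β)| ≤ K′·(k+1)·(Lc^{k+1})⁻¹·e^{−κ₁‖c − x″‖∞}`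
(`κ₁ = min κ₀ (δK∕4)` from leaf-12's rate and the K-slot's; `KSlotAssembly.convCK_holds` ⟹ `UnitDecayK 3 Lc (sfStep Lc) (smStep 3 Lc) CK δK`).  By part 3a's `unitK_coDressKBmAt_inr_inr`
the same law holds with the CO-DRESSED kernel `K♮ᴱ_m` in place of `unitK_m (KInvStep Lc m)` — the object leaf-01's `kChain (krow ∘ K♮ᴱ)` reads at `f = inr β`.  Windows of
length one (the mm block alone, no chain above) are the K-slot's `Decays` directly.  Asserts NOTHING about Bałaban's tables beyond the tree's K-slot; NOT (H1♮); NEVER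
«G-an2-4 closed» as (CONV-C); NOT D1, NOT `BetaPertH`, NOT continuum, NOT Clay.  2026-08-23; no existing file touched.
-/

noncomputable section

open Finset
open scoped BigOperators
open Literature.MathematicalPhysics.QuantumFieldTheory
open Literature.MathematicalPhysics.QuantumFieldTheory.LatticeForm (quo)
open Literature.MathematicalPhysics.QuantumFieldTheory.Balaban1983to89
open Literature.MathematicalPhysics.QuantumFieldTheory.Balaban1983to89.Beta
open B4ContourShift (supNorm supNorm_nonneg)
open B12Sec2to5 (l1 l1_nonneg)
open ExpKernelCalculus (MKer Decays Zl Zl_nonneg)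
open OneStepResolventKernel (Fib)
open OneStepKernelFamily (KInvStep)
open AffineAveraging (Site box toSite)
open AveragingContours (blk off off_mem_box blk_add_off)
open Summit.QuantumFields.BalabanUV.Beta.HessKerDressedUnits (unitK)
open Summit.QuantumFields.BalabanUV.Beta.GAN24.CombesThomas (sfStep smStep UnitDecayK ConvCK)
open Summit.QuantumFields.BalabanUV.Beta.GAN24.KSlotAssembly (convCK_holds)
open Summit.QuantumFields.BalabanUV.Beta.GAN24.Push4Iter (legChain)
open Summit.QuantumFields.BalabanUV.Beta.GAN24.RespStepBmDecompExact (respStepBmSeq)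
open Summit.QuantumFields.BalabanUV.Beta.GAN24.DressedLegBlockL1Envelope (exists_legChain_blockL1_envelope)
open Summit.QuantumFields.BalabanUV.Beta.GAN24.DressedLegBlockL1MultiplierColumn (sum_box_abs_comp_mm_le summable_mul_of_decay)

namespace Summit.QuantumFields.BalabanUV.Beta.GAN24.DressedLegMultiplierColumnEnvelope

section Four

variable {Lc : ℕ} [NeZero Lc]

/-- NOT IN PRINT; OUR BOOKKEEPING.  **THE MULTIPLIER-COLUMN PART OF THE CARRIER's COMPOSITE KERNEL LEG IS `T^B`-SIZED IN BLOCK-ℓ¹** (`d = 3`, `2 ≤ Lc`,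
in-block root): ONE rate `κ₁ > 0` and ONE `K′ ≥ 0` with, for every in-block root `rr` and ALL `m k α x″ β c`,
`Σ_{t ∈ box (Lc^{k+2})} |Σ′_{x′} Σ_{α′} legChain (respStepBmSeq ρ Lc) (m+1) k α x″ α′ x′ · (unitK_m (KInvStep Lc m)) (Lc•x′) (Lc^{k+2}•c + t) (inr α′) (inr β)| ≤ K′·(k+1)·(Lc^{k+1})⁻¹·e^{−κ₁‖c − x″‖∞}`
— part 2's `exists_legChain_blockL1_envelope` for the chain (weakened to rate `κ₁ := min κ₀ (δK∕4)`), the LANDED K-slot `KSlotAssembly.convCK_holds` for the mm block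
(`UnitDecayK`: `|unitK_m (KInvStep Lc m) y x a b| ≤ CK·e^{−δK|y − x|₁}` at every level), and §3 fibre by fibre; by §1 the same bound holds with the co-dressed kernel's mm block. -/
theorem exists_legChain_mmColumn_blockL1_envelope (hLc : 2 ≤ Lc) :
    ∃ κ₁ K' : ℝ, 0 < κ₁ ∧ 0 ≤ K' ∧ ∀ (rr : Fin (3 + 1) → ℕ), rr ∈ box (3 + 1) Lc →
      ∀ (m k : ℕ) (α : Fin (3 + 1)) (xs : Site (3 + 1)) (β : Fin (3 + 1)) (c : Site (3 + 1)),
        ∑ t ∈ box (3 + 1) (Lc ^ (k + 2)),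
            |∑' x', ∑ α' : Fin (3 + 1), legChain (respStepBmSeq (d := 3) (toSite rr) Lc) (m + 1) k α xs α' x' *
                unitK (sfStep Lc m) (smStep 3 Lc m) (KInvStep (d := 3) Lc m) ((Lc : ℤ) • x')
                  (((Lc ^ (k + 2) : ℕ) : ℤ) • c + toSite t) (Sum.inr α') (Sum.inr β)|
          ≤ K' * ((k : ℝ) + 1) * ((Lc : ℝ) ^ (k + 1))⁻¹ * Real.exp (-(κ₁ * supNorm (c - xs))) := by
  classical
  have hLc1 : 1 ≤ Lc := le_trans (by norm_num) hLc
  obtain ⟨κ₀, K, hκ₀, hK, hlaw⟩ := exists_legChain_blockL1_envelope (Lc := Lc)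
  obtain ⟨CK, δK, cc, θ, hδK, -, -, hU, -⟩ := convCK_holds (Lc := Lc) hLc
  have hCK : 0 ≤ CK := by
    have h := hU 0 0 0 (Sum.inl 0) (Sum.inl 0)
    have h0 : (0 : ℝ) ≤ CK * Real.exp (-δK * l1 ((0 : Site (3 + 1)) - 0)) := (abs_nonneg _).trans h
    rw [sub_self] at h0
    have : l1 (0 : Site (3 + 1)) = 0 := by unfold l1; simp
    rw [this, mul_zero, Real.exp_zero, mul_one] at h0
    exact h0
  set κ₁ : ℝ := min κ₀ (δK / 4) with hκ₁
  have hκ₁0 : 0 < κ₁ := lt_min hκ₀ (by positivity)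
  have hκ₁κ₀ : κ₁ ≤ κ₀ := min_le_left _ _
  have h4 : 4 * κ₁ ≤ δK := by have := min_le_right κ₀ (δK / 4); rw [← hκ₁] at this; linarith
  set Z : ℝ := CK * Zl (3 + 1) (δK / 2) * Real.exp (3 * κ₁) * Zl (3 + 1) (κ₁ / ((3 : ℝ) + 1)) with hZ
  have hZ0 : 0 ≤ Z := by
    have := Zl_nonneg (D := 3 + 1) (show 0 < δK / 2 by positivity)
    have := Zl_nonneg (D := 3 + 1) (show 0 < κ₁ / ((3 : ℝ) + 1) by positivity)
    rw [hZ]; positivity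
  refine ⟨κ₁, 4 * K * Z, hκ₁0, by positivity, ?_⟩
  intro rr hrr m k α xs β c
  set a : ℝ := K * ((k : ℝ) + 1) * ((Lc : ℝ) ^ (k + 1))⁻¹ with ha
  have ha0 : 0 ≤ a := by rw [ha]; positivity
  -- per column fibre `α'`: the chain's block mass at rate `κ₁`, the mm block's decay
  have hA : ∀ (α' : Fin (3 + 1)) (c' : Site (3 + 1)),
      ∑ s ∈ box (3 + 1) (Lc ^ (k + 1)), |legChain (respStepBmSeq (d := 3) (toSite rr) Lc) (m + 1) k α xs α' (((Lc ^ (k + 1) : ℕ) : ℤ) • c' + toSite s)|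
        ≤ a * Real.exp (-(κ₁ * supNorm (c' - xs))) := by
    intro α' c'
    refine (hlaw rr hrr (m + 1) k α xs α' c').trans ?_
    rw [ha]
    refine mul_le_mul_of_nonneg_left ?_ (by positivity)
    rw [Real.exp_le_exp]
    have := supNorm_nonneg (c' - xs)
    nlinarith
  have hM : ∀ (α' : Fin (3 + 1)) (x' x : Site (3 + 1)),
      |unitK (sfStep Lc m) (smStep 3 Lc m) (KInvStep (d := 3) Lc m) ((Lc : ℤ) • x') x (Sum.inr α') (Sum.inr β)|
        ≤ CK * Real.exp (-δK * l1 ((Lc : ℤ) • x' - x)) := fun α' x' x => hU m _ _ _ _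
  -- per fibre bound by §3
  have hfib : ∀ α' : Fin (3 + 1), ∑ t ∈ box (3 + 1) (Lc ^ (k + 2)),
      |∑' x', legChain (respStepBmSeq (d := 3) (toSite rr) Lc) (m + 1) k α xs α' x' *
          unitK (sfStep Lc m) (smStep 3 Lc m) (KInvStep (d := 3) Lc m) ((Lc : ℤ) • x') (((Lc ^ (k + 2) : ℕ) : ℤ) • c + toSite t) (Sum.inr α') (Sum.inr β)|
        ≤ a * Z * Real.exp (-(κ₁ * supNorm (c - xs))) := by
    intro α'
    have h := sum_box_abs_comp_mm_le (d := 3) hLc1 k hκ₁0 hδK h4 ha0 hCK xs (hA α') (hM α') c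
    refine h.trans (le_of_eq ?_)
    rw [hZ]; ring
  -- summability per fibre (for the finite fibre sum ∕ series interchange)
  have hAb : ∀ (α' : Fin (3 + 1)) (x' : Site (3 + 1)), |legChain (respStepBmSeq (d := 3) (toSite rr) Lc) (m + 1) k α xs α' x'| ≤ a := by
    intro α' x'
    haveI : NeZero (Lc ^ (k + 1)) := ⟨pow_ne_zero _ (NeZero.ne Lc)⟩
    have hL1 : 1 ≤ Lc ^ (k + 1) := Nat.one_le_pow _ _ hLc1
    have hx := blk_add_off hL1 x'
    have h1 : |legChain (respStepBmSeq (d := 3) (toSite rr) Lc) (m + 1) k α xs α' x'|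
        ≤ ∑ s ∈ box (3 + 1) (Lc ^ (k + 1)), |legChain (respStepBmSeq (d := 3) (toSite rr) Lc) (m + 1) k α xs α' (((Lc ^ (k + 1) : ℕ) : ℤ) • blk (Lc ^ (k + 1)) x' + toSite s)| := by
      conv_lhs => rw [← hx]
      exact Finset.single_le_sum (f := fun s => |legChain (respStepBmSeq (d := 3) (toSite rr) Lc) (m + 1) k α xs α'
        (((Lc ^ (k + 1) : ℕ) : ℤ) • blk (Lc ^ (k + 1)) x' + toSite s)|) (fun _ _ => abs_nonneg _) (off_mem_box hL1 x')
    refine h1.trans ((hA α' _).trans ?_)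
    have : Real.exp (-(κ₁ * supNorm (blk (Lc ^ (k + 1)) x' - xs))) ≤ 1 := by
      rw [Real.exp_le_one_iff]; have := supNorm_nonneg (blk (Lc ^ (k + 1)) x' - xs); nlinarith
    nlinarith
  have hsum : ∀ (α' : Fin (3 + 1)) (x : Site (3 + 1)), Summable fun x' =>
      legChain (respStepBmSeq (d := 3) (toSite rr) Lc) (m + 1) k α xs α' x' *
        unitK (sfStep Lc m) (smStep 3 Lc m) (KInvStep (d := 3) Lc m) ((Lc : ℤ) • x') x (Sum.inr α') (Sum.inr β) :=
    fun α' x => summable_mul_of_decay (d := 3) hLc1 hδK ha0 hCK (hAb α') (hM α') x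
  -- assemble: interchange the finite fibre sum with the series, triangle, sum the four fibres
  calc ∑ t ∈ box (3 + 1) (Lc ^ (k + 2)),
          |∑' x', ∑ α' : Fin (3 + 1), legChain (respStepBmSeq (d := 3) (toSite rr) Lc) (m + 1) k α xs α' x' *
              unitK (sfStep Lc m) (smStep 3 Lc m) (KInvStep (d := 3) Lc m) ((Lc : ℤ) • x')
                (((Lc ^ (k + 2) : ℕ) : ℤ) • c + toSite t) (Sum.inr α') (Sum.inr β)|
      = ∑ t ∈ box (3 + 1) (Lc ^ (k + 2)),
          |∑ α' : Fin (3 + 1), ∑' x', legChain (respStepBmSeq (d := 3) (toSite rr) Lc) (m + 1) k α xs α' x' *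
              unitK (sfStep Lc m) (smStep 3 Lc m) (KInvStep (d := 3) Lc m) ((Lc : ℤ) • x')
                (((Lc ^ (k + 2) : ℕ) : ℤ) • c + toSite t) (Sum.inr α') (Sum.inr β)| :=
        Finset.sum_congr rfl fun t _ => by rw [Summable.tsum_finsetSum (fun α' _ => hsum α' _)]
    _ ≤ ∑ t ∈ box (3 + 1) (Lc ^ (k + 2)), ∑ α' : Fin (3 + 1),
          |∑' x', legChain (respStepBmSeq (d := 3) (toSite rr) Lc) (m + 1) k α xs α' x' *
              unitK (sfStep Lc m) (smStep 3 Lc m) (KInvStep (d := 3) Lc m) ((Lc : ℤ) • x')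
                (((Lc ^ (k + 2) : ℕ) : ℤ) • c + toSite t) (Sum.inr α') (Sum.inr β)| :=
        Finset.sum_le_sum fun t _ => Finset.abs_sum_le_sum_abs _ _
    _ = ∑ α' : Fin (3 + 1), ∑ t ∈ box (3 + 1) (Lc ^ (k + 2)),
          |∑' x', legChain (respStepBmSeq (d := 3) (toSite rr) Lc) (m + 1) k α xs α' x' *
              unitK (sfStep Lc m) (smStep 3 Lc m) (KInvStep (d := 3) Lc m) ((Lc : ℤ) • x')
                (((Lc ^ (k + 2) : ℕ) : ℤ) • c + toSite t) (Sum.inr α') (Sum.inr β)| := Finset.sum_comm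
    _ ≤ ∑ _α' : Fin (3 + 1), a * Z * Real.exp (-(κ₁ * supNorm (c - xs))) := Finset.sum_le_sum fun α' _ => hfib α'
    _ = 4 * K * Z * ((k : ℝ) + 1) * ((Lc : ℝ) ^ (k + 1))⁻¹ * Real.exp (-(κ₁ * supNorm (c - xs))) := by
        rw [Finset.sum_const, Finset.card_univ, Fintype.card_fin, nsmul_eq_mul, ha]; push_cast; ring

end Four

end Summit.QuantumFields.BalabanUV.Beta.GAN24.DressedLegMultiplierColumnEnvelope

end
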